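import Mathlib
import HarnessLib
import Summits.NavierStokesRegularity.NavierStokesRegularity.Theses.LevelSetModeration
import Summits.NavierStokesRegularity.NavierStokesRegularity.Theorems.LevelSetModerationHighSpeedPressureWorkConsequences
import Summits.NavierStokesRegularity.NavierStokesRegularity.Theorems.LevelSetModerationLevelSetClosure
import Summits.NavierStokesRegularity.NavierStokesRegularity.Theorems.LevelSetModerationLevelSetClosureSliceGain
import Summits.NavierStokesRegularity.NavierStokesRegularity.Theorems.LevelSetModerationLevelSetClosureStampacchia
import Summits.NavierStokesRegularity.NavierStokesRegularity.Theorems.LevelSetModerationLevelSetClosureTools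

/-!
# Route LevelSetModeration — crux `HighSpeedPressureWork`, line `linear_closure`:
# stub L2 `stub_uniformLevelSetClosure` (the class-uniform De Giorgi closure)

The registered stub `stub_uniformLevelSetClosure` of item stmt-NavierStokesRegularity-18149 (line
`linear_closure`, L2): for `ν, T > 0`, `m < 10/3`, `M₀ > 0`, a real `Λ` and an energy bound `E₀`
there is a constant `G = G(ν, T, m, Λ, E₀, M₀)` such that EVERY classical Leray–Hopf solution from a
rapidly decaying datum with `∫|u₀|² ≤ E₀`, `|u₀| ≤ M₀/2` obeying the LINEAR level-set law
`ν² D_c(T) ≤ Λ M^m V_c(T)`, `∫(|u(t)|−c)₊² ≤ 4 Λ M^m V_c(T)/ν` on all windows `M ≥ M₀`,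
`c ∈ [M/2, M]`, is bounded by `G` on `[0, T)`.

This is the landed crux-3 proof `levelSetClosure_proof` (Theorems/LevelSetModerationLevelSetClosure.lean;
Vasseur 2007 §4 in De Giorgi's volume bookkeeping, closed by Stampacchia's lemma) made CLASS-UNIFORM:
the closing window `M` is chosen BEFORE the solution, from `exists_window_threshold` with the two
solution-dependent numbers `∫|u₀|²`, `½∫|u₀|²` of the base step replaced by their bounds
`max(E₀,0)`, `max(E₀,0)/2` (they enter the base `V(M/2) ≤ (16/M)^{10/3} K² (∫|u₀|²)^{2/3} (½∫|u₀|²)/ν`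
monotonically); the De Giorgi input is now the hypothesis (linear law, `Λ ≤ max(Λ,0)`), and the
autonomous two-level gain `V(h) ≤ (c₀ M^{5m/3}+1)(h−k)^{-10/3} V(k)^{5/3}` (`levelVolume_twoLevel_le`),
Stampacchia (`LevelSetClosure.stub_stampacchia`) and the open-null-empty endgame
(`LevelSetClosure.tools_openNullEmpty`) are verbatim. Then `G := M`.

References: A. Vasseur, NoDEA 14 (2007), Lemma 4, Lemma 11, §4 [Vasseur2007]; E. De Giorgi (1957);
D. Kinderlehrer–G. Stampacchia, *Variational inequalities*, II Lemma B.1.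
-/

noncomputable section

-- single-conjunct summit: `Summit.<Summit>.<Problem>` repeats the name by the D-0017 layout
set_option linter.dupNamespace false

namespace Summit.NavierStokesRegularity.NavierStokesRegularity.Theorems

open MeasureTheory Set Filter Topology Function
open scoped ENNReal NNReal
open Literature.Analysis.FluidPDE
open Summit.NavierStokesRegularity.NavierStokesRegularity.Theses.LevelSetModeration

/-- Algebra of the autonomous two-level gain: from
`φ(h) ≤ (4/(h−k))^{10/3} K² S^{2/3} (Λ' M^m φ(k)/ν²)`, `S = 4Λ'M^mφ(k)/ν`, to
`φ(h) ≤ (c₀ (M^m)^{5/3} + 1)(h−k)^{-10/3} φ(k)^{5/3}`, `c₀ = 4^{10/3} K² (4Λ'/ν)^{2/3} Λ'/ν²`.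
[folklore] -/
theorem uniformLevelSetClosure_gainAlgebra {K Λ' ν M m h k φh φk : ℝ} (hν : 0 < ν)
    (hΛ' : 0 ≤ Λ') (hM : 0 < M) (hkh : k < h) (hφk : 0 ≤ φk)
    (h1 : φh ≤ (4 / (h - k)) ^ (10 / 3 : ℝ) * K ^ 2 *
        (4 * (Λ' * M ^ m * φk) / ν) ^ (2 / 3 : ℝ) * (Λ' * M ^ m * φk / ν ^ 2)) :
    φh ≤ ((4:ℝ) ^ (10 / 3 : ℝ) * K ^ 2 * (4 * Λ' / ν) ^ (2 / 3 : ℝ) * (Λ' / ν ^ 2) *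
        (M ^ m) ^ (5 / 3 : ℝ) + 1) / (h - k) ^ (10 / 3 : ℝ) * φk ^ (5 / 3 : ℝ) := by
  set c₀ : ℝ := (4:ℝ) ^ (10 / 3 : ℝ) * K ^ 2 * (4 * Λ' / ν) ^ (2 / 3 : ℝ) * (Λ' / ν ^ 2) with hc₀
  have hXpos : 0 < M ^ m := Real.rpow_pos_of_pos hM m
  have hhk : 0 ≤ h - k := by linarith
  have e1 : (4 / (h - k)) ^ (10 / 3 : ℝ) = (4:ℝ) ^ (10 / 3 : ℝ) / (h - k) ^ (10 / 3 : ℝ) :=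
    Real.div_rpow (by norm_num) hhk _
  have e2 : (4 * (Λ' * M ^ m * φk) / ν) ^ (2 / 3 : ℝ) =
      (4 * Λ' / ν) ^ (2 / 3 : ℝ) * (M ^ m) ^ (2 / 3 : ℝ) * φk ^ (2 / 3 : ℝ) := by
    rw [show 4 * (Λ' * M ^ m * φk) / ν = (4 * Λ' / ν) * M ^ m * φk by ring,
      Real.mul_rpow (by positivity) hφk, Real.mul_rpow (by positivity) hXpos.le]
  have e3 : (M ^ m) ^ (5 / 3 : ℝ) = (M ^ m) ^ (2 / 3 : ℝ) * M ^ m := by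
    rw [show (5 / 3 : ℝ) = 2 / 3 + 1 by norm_num, Real.rpow_add hXpos, Real.rpow_one]
  have e4 : φk ^ (5 / 3 : ℝ) = φk ^ (2 / 3 : ℝ) * φk := by
    rw [show (5 / 3 : ℝ) = 2 / 3 + 1 by norm_num, Real.rpow_add' hφk (by norm_num), Real.rpow_one]
  have h2 : (4 / (h - k)) ^ (10 / 3 : ℝ) * K ^ 2 * (4 * (Λ' * M ^ m * φk) / ν) ^ (2 / 3 : ℝ) *
      (Λ' * M ^ m * φk / ν ^ 2) =
      c₀ * (M ^ m) ^ (5 / 3 : ℝ) / (h - k) ^ (10 / 3 : ℝ) * φk ^ (5 / 3 : ℝ) := by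
    rw [e1, e2, e3, e4, hc₀]
    ring
  have h3 : c₀ * (M ^ m) ^ (5 / 3 : ℝ) / (h - k) ^ (10 / 3 : ℝ) * φk ^ (5 / 3 : ℝ) ≤
      (c₀ * (M ^ m) ^ (5 / 3 : ℝ) + 1) / (h - k) ^ (10 / 3 : ℝ) * φk ^ (5 / 3 : ℝ) := by
    apply mul_le_mul_of_nonneg_right _ (Real.rpow_nonneg hφk _)
    exact div_le_div_of_nonneg_right (by linarith) (Real.rpow_nonneg hhk _)
  linarith [h1, h2.le, h3]

/-- The Stampacchia size condition on the window `[M/2, M]` from the threshold inequality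
`2^{10/3}·2^{25/3}·(16^{10/3}B₀)^{2/3}·(c₀ M^{5m/3−50/9} + M^{−50/9}) ≤ 1` and the base bound
`x = φ(M/2) ≤ (16/M)^{10/3} B₀`. [folklore] -/
theorem uniformLevelSetClosure_stampacchiaSize {c₀ B₀ M m x : ℝ} (hc₀0 : 0 ≤ c₀) (hB₀0 : 0 ≤ B₀)
    (hMpos : 0 < M) (hx0 : 0 ≤ x) (hb : x ≤ (16 / M) ^ (10 / 3 : ℝ) * B₀)
    (hthr : (2:ℝ) ^ (10 / 3 : ℝ) * (2:ℝ) ^ (25 / 3 : ℝ) * ((16:ℝ) ^ (10 / 3 : ℝ) * B₀) ^ (2 / 3 : ℝ) *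
        (c₀ * M ^ (m * (5 / 3) - 50 / 9) + M ^ (-(50 / 9) : ℝ)) ≤ 1) :
    (c₀ * (M ^ m) ^ (5 / 3 : ℝ) + 1) * x ^ (5 / 3 - 1 : ℝ) *
        (2:ℝ) ^ ((10 / 3 : ℝ) * (5 / 3) / (5 / 3 - 1)) ≤ (M / 2) ^ (10 / 3 : ℝ) := by
  have eβ : (5 / 3 - 1 : ℝ) = 2 / 3 := by norm_num
  have eαβ : ((10 / 3 : ℝ) * (5 / 3) / (5 / 3 - 1)) = 25 / 3 := by norm_num
  rw [eαβ, eβ]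
  -- `x^{2/3} ≤ (16^{10/3} B₀)^{2/3} M^{-20/9}`
  have hφ23 : x ^ (2 / 3 : ℝ) ≤ ((16:ℝ) ^ (10 / 3 : ℝ) * B₀) ^ (2 / 3 : ℝ) * M ^ (-(20 / 9) : ℝ) := by
    have h1 : x ^ (2 / 3 : ℝ) ≤ ((16 / M) ^ (10 / 3 : ℝ) * B₀) ^ (2 / 3 : ℝ) :=
      Real.rpow_le_rpow hx0 hb (by norm_num)
    have h2 : ((16 / M) ^ (10 / 3 : ℝ) * B₀) ^ (2 / 3 : ℝ) =
        ((16:ℝ) ^ (10 / 3 : ℝ) * B₀) ^ (2 / 3 : ℝ) * M ^ (-(20 / 9) : ℝ) := by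
      rw [Real.div_rpow (by norm_num) hMpos.le, div_mul_eq_mul_div,
        Real.div_rpow (by positivity) (Real.rpow_nonneg hMpos.le _),
        ← Real.rpow_mul hMpos.le, Real.rpow_neg hMpos.le, div_eq_mul_inv]
      norm_num
    rw [h2] at h1
    exact h1
  -- `(M^m)^{5/3} = M^{m·5/3}` and the bookkeeping of the powers of `M`
  have eX : (M ^ m) ^ (5 / 3 : ℝ) = M ^ (m * (5 / 3)) := (Real.rpow_mul hMpos.le m _).symm
  have eM1 : M ^ (m * (5 / 3)) * M ^ (-(20 / 9) : ℝ) =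
      M ^ (m * (5 / 3) - 50 / 9) * M ^ (10 / 3 : ℝ) := by
    rw [← Real.rpow_add hMpos, ← Real.rpow_add hMpos]; ring_nf
  have eM2 : M ^ (-(20 / 9) : ℝ) = M ^ (-(50 / 9) : ℝ) * M ^ (10 / 3 : ℝ) := by
    rw [← Real.rpow_add hMpos]; norm_num
  have eM3 : (M / 2) ^ (10 / 3 : ℝ) = M ^ (10 / 3 : ℝ) / (2:ℝ) ^ (10 / 3 : ℝ) :=
    Real.div_rpow hMpos.le (by norm_num) _
  have h2pos : (0:ℝ) < (2:ℝ) ^ (10 / 3 : ℝ) := by positivity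
  have hCpos : 0 ≤ c₀ * (M ^ m) ^ (5 / 3 : ℝ) + 1 := by positivity
  -- the main estimate
  set b₁ : ℝ := ((16:ℝ) ^ (10 / 3 : ℝ) * B₀) ^ (2 / 3 : ℝ) with hb₁
  have hb₁0 : 0 ≤ b₁ := by positivity
  calc (c₀ * (M ^ m) ^ (5 / 3 : ℝ) + 1) * x ^ (2 / 3 : ℝ) * (2:ℝ) ^ (25 / 3 : ℝ)
      ≤ (c₀ * (M ^ m) ^ (5 / 3 : ℝ) + 1) * (b₁ * M ^ (-(20 / 9) : ℝ)) *
          (2:ℝ) ^ (25 / 3 : ℝ) := by gcongr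
    _ = ((2:ℝ) ^ (10 / 3 : ℝ) * (2:ℝ) ^ (25 / 3 : ℝ) * b₁ *
          (c₀ * M ^ (m * (5 / 3) - 50 / 9) + M ^ (-(50 / 9) : ℝ))) *
          (M ^ (10 / 3 : ℝ) / (2:ℝ) ^ (10 / 3 : ℝ)) := by
        rw [eX]
        have : (c₀ * M ^ (m * (5 / 3)) + 1) * (b₁ * M ^ (-(20 / 9) : ℝ)) =
            b₁ * (c₀ * (M ^ (m * (5 / 3)) * M ^ (-(20 / 9) : ℝ)) + M ^ (-(20 / 9) : ℝ)) := by
          ring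
        rw [this, eM1, eM2]
        field_simp
    _ ≤ 1 * (M ^ (10 / 3 : ℝ) / (2:ℝ) ^ (10 / 3 : ℝ)) := by
        apply mul_le_mul_of_nonneg_right hthr (by positivity)
    _ = (M / 2) ^ (10 / 3 : ℝ) := by rw [one_mul, eM3]

/-- **`stub_uniformLevelSetClosure`** (registered stub L2 of line `linear_closure`, crux
`HighSpeedPressureWork`, item stmt-NavierStokesRegularity-18149): the class-uniform De Giorgi
closure — the linear level-set law with `(Λ, m)`, `m < 10/3`, on all windows `M ≥ M₀` bounds the
speed of every classical Leray–Hopf solution from a rapidly decaying datum with `∫|u₀|² ≤ E₀`,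
`|u₀| ≤ M₀/2` by a constant depending only on `(ν, T, m, Λ, E₀, M₀)` (Vasseur 2007, §4; De Giorgi
1957; Stampacchia). [cite: Vasseur2007, §4] -/
theorem stub_uniformLevelSetClosure :
    ∀ (ν T m Λ E₀ M₀ : ℝ), 0 < ν → 0 < T → m < 10 / 3 → 0 < M₀ → ∃ G : ℝ,
      ∀ (u : ℝ → EuclideanSpace ℝ (Fin 3) → EuclideanSpace ℝ (Fin 3))
        (p : ℝ → EuclideanSpace ℝ (Fin 3) → ℝ),
        Literature.Analysis.FluidPDE.IsClassicalNSSolutionOn (Set.Ico 0 T) ν 0 u p →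
        Literature.Analysis.FluidPDE.IsLerayHopfOn T ν 0 (u 0) u →
        Literature.Analysis.FluidPDE.HasRapidSpatialDecay (u 0) →
        (∫ x, ‖u 0 x‖ ^ 2) ≤ E₀ → (∀ x, ‖u 0 x‖ ≤ M₀ / 2) →
        (∀ (M c : ℝ), M₀ ≤ M → M / 2 ≤ c → c ≤ M → 0 < c →
          ν ^ 2 * (∫⁻ τ in Set.Ioo 0 T, ∫⁻ x, Set.indicator {x | c < ‖u τ x‖}
                (fun x => ENNReal.ofReal (‖fderiv ℝ (fun y => ‖u τ y‖) x‖ ^ 2)) x).toReal ≤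
              Λ * M ^ m * (∫⁻ τ in Set.Ioo 0 T, volume {x | c < ‖u τ x‖}).toReal ∧
          ∀ t ∈ Set.Ico 0 T, (∫ x, (max (‖u t x‖ - c) 0) ^ 2) ≤
              4 * (Λ * M ^ m * (∫⁻ τ in Set.Ioo 0 T, volume {x | c < ‖u τ x‖}).toReal) / ν) →
        ∀ t ∈ Set.Ico 0 T, ∀ x, ‖u t x‖ ≤ G := by
  intro ν T m Λ E₀ M₀ hν hT hm hM₀
  -- ### constants independent of the solution
  set K : ℝ := (SNormLESNormFDerivOfEqConst ℝ (volume : Measure (EuclideanSpace ℝ (Fin 3))) 2 : ℝ)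
    with hK
  have hK0 : 0 ≤ K := NNReal.coe_nonneg _
  set Λ' : ℝ := max Λ 0 with hΛ'
  have hΛ'0 : 0 ≤ Λ' := le_max_right _ _
  set E' : ℝ := max E₀ 0 with hE'
  have hE'0 : 0 ≤ E' := le_max_right _ _
  set c₀ : ℝ := (4:ℝ) ^ (10 / 3 : ℝ) * K ^ 2 * (4 * Λ' / ν) ^ (2 / 3 : ℝ) * (Λ' / ν ^ 2) with hc₀
  have hc₀0 : 0 ≤ c₀ := by positivity
  set B₀ : ℝ := K ^ 2 * E' ^ (2 / 3 : ℝ) * (E' / 2 / ν) with hB₀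
  have hB₀0 : 0 ≤ B₀ := by positivity
  -- choice of the closing window `M` (before the solution)
  obtain ⟨M, hMM₀, hM1, hthr⟩ := exists_window_threshold c₀
    ((2:ℝ) ^ (10 / 3 : ℝ) * (2:ℝ) ^ (25 / 3 : ℝ) * ((16:ℝ) ^ (10 / 3 : ℝ) * B₀) ^ (2 / 3 : ℝ))
    M₀ (m * (5 / 3) - 50 / 9) (-(50 / 9)) (by linarith) (by norm_num)
  have hMpos : 0 < M := by linarith
  have hM0 : M₀ ≤ M := hMM₀
  refine ⟨M, ?_⟩
  intro u p hcl hLH _ hE hu0 hlaw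
  -- ### the solution: abbreviations and Leray–Hopf facts
  set KE : ℝ := VectorCalculus.kineticEnergy (u 0) with hKE
  set E2 : ℝ := ∫ x, ‖u 0 x‖ ^ 2 with hE2
  have hKE0 : 0 ≤ KE := kineticEnergy_nonneg (u 0)
  have hE20 : 0 ≤ E2 := integral_nonneg fun _ => sq_nonneg _
  have hE2E' : E2 ≤ E' := hE.trans (le_max_left _ _)
  have hKEE' : KE ≤ E' / 2 := by
    have : KE = 2⁻¹ * E2 := rfl
    rw [this]; linarith
  set V : ℝ → ℝ≥0∞ := fun c => ∫⁻ τ in Ioo 0 T, volume {x | c < ‖u τ x‖} with hV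
  set D : ℝ → ℝ≥0∞ := fun c => ∫⁻ τ in Ioo 0 T, ∫⁻ x, {x | c < ‖u τ x‖}.indicator
      (fun x => ENNReal.ofReal (‖fderiv ℝ (fun y => ‖u τ y‖) x‖ ^ 2)) x with hD
  set φ : ℝ → ℝ := fun c => (V c).toReal with hφ
  have hφ0 : ∀ c, 0 ≤ φ c := fun c => ENNReal.toReal_nonneg
  -- regularity of the slices
  have hreg : ∀ τ ∈ Ioo 0 T, ContDiff ℝ 1 (u τ) ∧ MemLp (u τ) 2 volume := fun τ hτ =>
    ⟨(hcl.contDiff_velocity (Ioo_subset_Ico_self hτ)).of_le (by exact_mod_cast le_top),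
      hLH.memLp τ (Ioo_subset_Icc_self hτ)⟩
  -- (F1) finiteness and monotonicity of the volume profile
  have hVfin : ∀ c, 0 < c → V c ≠ ∞ := fun c hc =>
    ne_top_of_le_ne_top ENNReal.ofReal_ne_top (levelSetVolume_le hLH hν.le hT.le hc)
  have hVmono : ∀ a b, a ≤ b → V b ≤ V a := fun a b hab => by
    simp only [hV]
    exact lintegral_mono fun τ => measure_mono fun x (hx : b < ‖u τ x‖) => lt_of_le_of_lt hab hx
  -- (F2) finiteness and uniform bound of the dissipation
  have hDfin : ∀ c, 0 ≤ c → D c ≠ ∞ ∧ ν * (D c).toReal ≤ KE := fun c hc =>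
    levelSetDissipation_ne_top hcl hLH hT hν.le hc
  -- (F3) slice energies
  have hEslice : ∀ τ ∈ Ioo 0 T, ∀ k, 0 ≤ k → ∫ x, (max (‖u τ x‖ - k) 0) ^ 2 ≤ E2 := by
    intro τ hτ k hk
    obtain ⟨hint, hle⟩ := integral_norm_sq_le_of_lerayHopf hLH hν.le (Ioo_subset_Icc_self hτ)
    refine le_trans (integral_mono_of_nonneg (ae_of_all _ fun x => sq_nonneg _) hint
      (ae_of_all _ fun x => ?_)) hle
    have h0 : 0 ≤ max (‖u τ x‖ - k) 0 := le_max_right _ _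
    have h1 : max (‖u τ x‖ - k) 0 ≤ ‖u τ x‖ :=
      max_le (by linarith [norm_nonneg (u τ x)]) (norm_nonneg _)
    exact pow_le_pow_left₀ h0 h1 2
  -- (F4) the De Giorgi input on a window, `Λ₊` form (= the hypothesis, the linear law)
  have hDG : ∀ M c, M₀ ≤ M → M / 2 ≤ c → c ≤ M →
      (D c).toReal ≤ Λ' * M ^ m * φ c / ν ^ 2 ∧
      ∀ t ∈ Ico 0 T, ∫ x, (max (‖u t x‖ - c) 0) ^ 2 ≤ 4 * (Λ' * M ^ m * φ c) / ν := by
    intro M c hM hMc hcM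
    have hMpos : 0 < M := lt_of_lt_of_le hM₀ hM
    have hc : 0 < c := by linarith
    obtain ⟨h2, h3⟩ := hlaw M c hM hMc hcM hc
    have hmono : Λ * M ^ m * (V c).toReal ≤ Λ' * M ^ m * φ c := by
      simp only [hφ]
      exact mul_le_mul_of_nonneg_right (mul_le_mul_of_nonneg_right (le_max_left _ _)
        (Real.rpow_nonneg hMpos.le m)) ENNReal.toReal_nonneg
    have hDreal : (D c).toReal ≤ Λ' * M ^ m * φ c / ν ^ 2 := by
      rw [le_div_iff₀ (by positivity)]
      have := h2
      simp only [hD] at this ⊢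
      nlinarith
    refine ⟨hDreal, fun t ht => ?_⟩
    have h4 := h3 t ht
    have h5 : 4 * (Λ * M ^ m * (V c).toReal) / ν ≤ 4 * (Λ' * M ^ m * φ c) / ν := by
      gcongr
    linarith
  -- (F7) the autonomous two-level gain on a window
  have hgain : ∀ M k h, M₀ ≤ M → M / 2 ≤ k → k < h → h ≤ M →
      φ h ≤ (c₀ * (M ^ m) ^ (5 / 3 : ℝ) + 1) / (h - k) ^ (10 / 3 : ℝ) * φ k ^ (5 / 3 : ℝ) := by
    intro M k h hM hMk hkh hhM
    have hMpos : 0 < M := lt_of_lt_of_le hM₀ hM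
    have hk : 0 < k := by linarith
    obtain ⟨hDk, hEk⟩ := hDG M k hM hMk (by linarith)
    have hS0 : 0 ≤ 4 * (Λ' * M ^ m * φ k) / ν := by
      have := Real.rpow_nonneg hMpos.le m
      positivity
    obtain ⟨-, hstep⟩ := levelVolume_twoLevel_le (u := u) (T := T) hk hkh hS0 hreg
      (fun τ hτ => hEk τ (Ioo_subset_Ico_self hτ)) (hDfin k hk.le).1
    have hpref : 0 ≤ (4 / (h - k)) ^ (10 / 3 : ℝ) * K ^ 2 *
        (4 * (Λ' * M ^ m * φ k) / ν) ^ (2 / 3 : ℝ) := by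
      have : 0 ≤ 4 / (h - k) := div_nonneg (by norm_num) (by linarith)
      positivity
    have h1 : φ h ≤ (4 / (h - k)) ^ (10 / 3 : ℝ) * K ^ 2 *
        (4 * (Λ' * M ^ m * φ k) / ν) ^ (2 / 3 : ℝ) * (Λ' * M ^ m * φ k / ν ^ 2) :=
      hstep.trans (mul_le_mul_of_nonneg_left hDk hpref)
    exact uniformLevelSetClosure_gainAlgebra hν hΛ'0 hMpos hkh (hφ0 k) h1
  -- (F9) the base of a window: one Sobolev step from level `M/4` with Leray–Hopf bounds
  have hbase : ∀ M, M₀ ≤ M → φ (M / 2) ≤ (16 / M) ^ (10 / 3 : ℝ) * B₀ := by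
    intro M hM
    have hMpos : 0 < M := lt_of_lt_of_le hM₀ hM
    have hk : 0 < M / 4 := by positivity
    obtain ⟨-, hstep⟩ := levelVolume_twoLevel_le (u := u) (T := T) (h := M / 2) hk
      (by linarith) hE20 hreg (fun τ hτ => hEslice τ hτ (M / 4) hk.le) (hDfin (M / 4) hk.le).1
    have hDk : (D (M / 4)).toReal ≤ E' / 2 / ν := by
      rw [le_div_iff₀ hν, mul_comm]
      exact (hDfin (M / 4) hk.le).2.trans hKEE'
    have hpref : 0 ≤ (4 / (M / 2 - M / 4)) ^ (10 / 3 : ℝ) * K ^ 2 * E2 ^ (2 / 3 : ℝ) := by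
      have : 0 ≤ 4 / (M / 2 - M / 4) := div_nonneg (by norm_num) (by linarith)
      positivity
    have h1 := hstep.trans (mul_le_mul_of_nonneg_left hDk hpref)
    have e1 : 4 / (M / 2 - M / 4) = 16 / M := by
      field_simp; ring
    rw [e1] at h1
    have hE23 : E2 ^ (2 / 3 : ℝ) ≤ E' ^ (2 / 3 : ℝ) := Real.rpow_le_rpow hE20 hE2E' (by norm_num)
    have h16 : 0 ≤ (16 / M) ^ (10 / 3 : ℝ) := Real.rpow_nonneg (by positivity) _
    have h2 : (16 / M) ^ (10 / 3 : ℝ) * K ^ 2 * E2 ^ (2 / 3 : ℝ) * (E' / 2 / ν) ≤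
        (16 / M) ^ (10 / 3 : ℝ) * K ^ 2 * E' ^ (2 / 3 : ℝ) * (E' / 2 / ν) := by
      have hq : 0 ≤ E' / 2 / ν := by positivity
      exact mul_le_mul_of_nonneg_right (mul_le_mul_of_nonneg_left hE23 (by positivity)) hq
    simp only [hφ, hB₀]
    linarith
  -- the Stampacchia threshold on the window `[M/2, M]`
  have hsize : (c₀ * (M ^ m) ^ (5 / 3 : ℝ) + 1) * φ (M / 2) ^ (5 / 3 - 1 : ℝ) *
      (2:ℝ) ^ ((10 / 3 : ℝ) * (5 / 3) / (5 / 3 - 1)) ≤ (M / 2) ^ (10 / 3 : ℝ) :=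
    uniformLevelSetClosure_stampacchiaSize hc₀0 hB₀0 hMpos (hφ0 _) (hbase M hM0) hthr
  -- Stampacchia on the window `[M/2, M]`
  have hzero : φ (M / 2 + M / 2) = 0 := by
    have hCpos : 0 < c₀ * (M ^ m) ^ (5 / 3 : ℝ) + 1 :=
      lt_of_lt_of_le zero_lt_one (le_add_of_nonneg_left
        (mul_nonneg hc₀0 (Real.rpow_nonneg (Real.rpow_nonneg hMpos.le m) (5 / 3 : ℝ))))
    have hM2 : 0 < M / 2 := half_pos hMpos
    refine LevelSetClosure.stub_stampacchia φ (M / 2) (M / 2) (c₀ * (M ^ m) ^ (5 / 3 : ℝ) + 1) (10 / 3)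
      (5 / 3) hCpos (by norm_num) (by norm_num) hM2
      (fun h _ => hφ0 h) ?_ ?_ hsize
    · intro a ha b _ hab
      have ha' : 0 < a := lt_of_lt_of_le hM2 (show M / 2 ≤ a from ha)
      simp only [hφ]
      exact ENNReal.toReal_mono (hVfin a ha') (hVmono a b hab)
    · intro k h hk hkh hh
      exact hgain M k h hM0 hk hkh (by linarith)
  rw [add_halves] at hzero
  have hVM : V M = 0 := by
    have h := (ENNReal.toReal_eq_zero_iff _).1 hzero
    exact h.resolve_right (hVfin M hMpos)
  -- Stampacchia on the window `[M/2, M]`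
  have hzero : φ (M / 2 + M / 2) = 0 := by
    have hCpos : 0 < c₀ * (M ^ m) ^ (5 / 3 : ℝ) + 1 :=
      lt_of_lt_of_le zero_lt_one (le_add_of_nonneg_left
        (mul_nonneg hc₀0 (Real.rpow_nonneg (Real.rpow_nonneg hMpos.le m) (5 / 3 : ℝ))))
    have hM2 : 0 < M / 2 := half_pos hMpos
    refine LevelSetClosure.stub_stampacchia φ (M / 2) (M / 2) (c₀ * (M ^ m) ^ (5 / 3 : ℝ) + 1) (10 / 3)
      (5 / 3) hCpos (by norm_num) (by norm_num) hM2
      (fun h _ => hφ0 h) ?_ ?_ hsize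
    · intro a ha b _ hab
      have ha' : 0 < a := lt_of_lt_of_le hM2 (show M / 2 ≤ a from ha)
      simp only [hφ]
      exact ENNReal.toReal_mono (hVfin a ha') (hVmono a b hab)
    · intro k h hk hkh hh
      exact hgain M k h hM0 hk hkh (by linarith)
  rw [add_halves] at hzero
  have hVM : V M = 0 := by
    have h := (ENNReal.toReal_eq_zero_iff _).1 hzero
    exact h.resolve_right (hVfin M hMpos)
  -- endgame: open-null-empty on `(0,T)`, the datum at `t = 0`
  have hcont : ContinuousOn (uncurry u) (Ico 0 T ×ˢ univ) := hcl.smooth_velocity.continuousOn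
  have hpos := LevelSetClosure.tools_openNullEmpty T M u hcont hVM
  intro t ht x
  rcases eq_or_lt_of_le ht.1 with h0 | h0
  · rw [← h0]
    exact (hu0 x).trans (by linarith)
  · exact hpos t ⟨h0, ht.2⟩ x

end Summit.NavierStokesRegularity.NavierStokesRegularity.Theorems

end
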